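import Literature.NumberTheory.Transcendental.MZVWordShuffle
import Literature.NumberTheory.Transcendental.MultipleZetaDuality
import HarnessLib

/-!
# The dual index of a multiple zeta value

Definitions file (Literature, `NumberTheory/Transcendental`): Hoffman's involution `τ` on
admissible indices (Hoffman 1992, §3 p. 281: `τ = Σ⁻¹ Rₙ Cₙ Σ` on the sequences of partial sums,
"we shall say the sequences `(i₁, …, i_k)` and `τ(i₁, …, i_k)` are dual to each other"; e.g.
`τ(3,4,1) = (3,1,1,2,1)`), in the equivalent description on binary words (Zagier 1994, §9): read the
word `ε(s) = 0^{s₁-1} 1 ⋯ 0^{s_k-1} 1` backwards and exchange the letters `0 ↔ 1`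
(`MZV.binaryWord`, `MZV.ofBinaryWord`). With it the duality theorem of
`MultipleZetaDuality.lean` takes its printed form `ζ(τ(s)) = ζ(s)` (`multipleZeta_dual`).

* `MZV.dual s` — the dual index `τ(s)`;
* `MZV.binaryWord_dual`, `MZV.isAdmissible_dual`, `MZV.weight_dual`, `MZV.dual_dual` (an
  involution on admissible indices), `MZV.depth_dual` is not needed here and omitted;
* `multipleZeta_dual : ζ(τ(s)) = ζ(s)` for admissible `s` (Hoffman's Duality conjecture,
  Hoffman 1992, §3 p. 282; a theorem by Kontsevich's integral, `multipleZeta_duality`).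

## References

* M. E. Hoffman, *Multiple harmonic series*, Pacific J. Math. 152 (1992), 275–290, §3 pp. 281–282.
  [Hoffman1992]
* D. Zagier, *Values of zeta functions and their applications*, ECM 1992, Progr. Math. 120 (1994),
  497–512, §9. [Zagier1994]
-/

namespace Literature.NumberTheory.Transcendental

namespace MZV

/-- **The dual index** `τ(s)`: the index whose binary word is that of `s` read backwards with the
letters `0 ↔ 1` exchanged (Hoffman 1992, §3 p. 281, in Zagier's word description; e.g.
`τ(3,4,1) = (3,1,1,2,1)`, `τ(2,2,1) = (3,2)`, `τ(n+2) = (2,{1}ⁿ)`). Meaningful on admissible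
indices (on others the junk conventions of `ofBinaryWord` apply). [cite: Hoffman1992, §3 p. 281] -/
def dual (s : List ℕ) : List ℕ :=
  ofBinaryWord ((binaryWord s).reverse.map fun b => !b)

/-- Hoffman's example `τ(3,4,1) = (3,1,1,2,1)` (1992, §3 p. 281), and `τ(2,2,1) = (3,2)`,
`τ(5) = (2,1,1,1)`. [cite: Hoffman1992, §3 p. 281] -/
theorem dual_examples : dual [3, 4, 1] = [3, 1, 1, 2, 1] ∧ dual [2, 2, 1] = [3, 2] ∧
    dual [5] = [2, 1, 1, 1] := by decide

/-- The dual of the empty index is empty. [folklore] -/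
@[simp] theorem dual_nil : dual [] = [] := rfl

/-- The reversed-and-complemented word of a nonempty admissible index is nonempty, begins with
`0` and ends with `1`. [folklore] -/
theorem reverse_map_not_binaryWord {s : List ℕ} (hs : IsAdmissible s) (hne : s ≠ []) :
    ((binaryWord s).reverse.map fun b => !b) ≠ [] ∧
      ((binaryWord s).reverse.map fun b => !b).head? ≠ some true ∧
      ((binaryWord s).reverse.map fun b => !b).getLast? = some true := by
  obtain ⟨l, hl⟩ := exists_binaryWord_eq_append_true hne
  obtain ⟨a, t, rfl⟩ := List.exists_cons_of_ne_nil hne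
  have ha : 2 ≤ a := by simpa using hs.2 (by simp)
  have hhead : binaryWord (a :: t) = false :: (List.replicate (a - 2) false ++ [true] ++ binaryWord t) := by
    rw [binaryWord, show a - 1 = (a - 2) + 1 by omega, List.replicate_succ]
    simp
  refine ⟨by rw [hl]; simp, by rw [hl]; simp, ?_⟩
  rw [hhead, List.reverse_cons, List.map_append, List.getLast?_append]
  simp

/-- **The binary word of the dual index** is the word of `s` read backwards with `0 ↔ 1`, for
admissible `s`. [cite: Hoffman1992, §3 p. 281] -/
theorem binaryWord_dual {s : List ℕ} (hs : IsAdmissible s) :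
    binaryWord (dual s) = (binaryWord s).reverse.map fun b => !b := by
  rcases eq_or_ne s [] with rfl | hne
  · rfl
  · obtain ⟨h1, -, h3⟩ := reverse_map_not_binaryWord hs hne
    exact binaryWord_ofBinaryWord h1 h3

/-- The dual of an admissible index is admissible (Hoffman 1992, §3 p. 281: "`τ(I)` is actually in
`𝔖`"). [cite: Hoffman1992, §3 p. 281] -/
theorem isAdmissible_dual {s : List ℕ} (hs : IsAdmissible s) : IsAdmissible (dual s) := by
  rcases eq_or_ne s [] with rfl | hne
  · exact isAdmissible_nil
  · exact isAdmissible_ofBinaryWord (reverse_map_not_binaryWord hs hne).2.1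

/-- The dual index has the same weight (Hoffman 1992, §3 p. 281: "its elements have sum `n`").
[cite: Hoffman1992, §3 p. 281] -/
theorem weight_dual {s : List ℕ} (hs : IsAdmissible s) : weight (dual s) = weight s :=
  weight_eq_of_binaryWord_eq_dual hs (isAdmissible_dual hs) (binaryWord_dual hs)

/-- `τ` is an involution on admissible indices (Hoffman 1992, §3 p. 281). [cite: Hoffman1992, §3 p. 281] -/
theorem dual_dual {s : List ℕ} (hs : IsAdmissible s) : dual (dual s) = s := by
  have h : ((binaryWord (dual s)).reverse.map fun b => !b) = binaryWord s := by
    rw [binaryWord_dual hs]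
    simp [List.map_reverse, Function.comp_def]
  rw [dual, h, ofBinaryWord_binaryWord hs.1]

end MZV

/-- **Duality of multiple zeta values, printed form**: `ζ(τ(s)) = ζ(s)` for every admissible
index `s` (Hoffman's Duality conjecture, Hoffman 1992, §3 p. 282: "If `(h₁, …, h_{n-k})` is dual to
`(i₁, …, i_k)`, then `A(h₁, …, h_{n-k}) = A(i₁, …, i_k)`"; a theorem by Kontsevich's integral
formula, `multipleZeta_duality`). [cite: Hoffman1992, §3 Duality conjecture p. 282] -/
theorem multipleZeta_dual {s : List ℕ} (hs : MZV.IsAdmissible s) :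
    multipleZeta (MZV.dual s) = multipleZeta s :=
  multipleZeta_duality hs (MZV.isAdmissible_dual hs) (MZV.binaryWord_dual hs)

end Literature.NumberTheory.Transcendental
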